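import Mathlib
import Literature.Topology.FourManifolds.BallGluingSeam

/-!
# OverbindingBudget (2c) — part 27Va-A: Taylor's bound along a segment (lens-4 g93; r1659 «VORONOI-PIVOT-93» S1)

Support file, pure analysis, no atlas.  For `g : E → ℝ` of class `C^{n+1}` on an open set `U`
containing the segment from `p` to `p + v`, with `‖D^{n+1} g‖ ≤ M` on that segment,

  `|g (p + v) − Σ_{k ≤ n} D^k g(p)[v, …, v] / k!| ≤ M ‖v‖^{n+1} / (n+1)!`        (`taylor_segment`)

and the spelled-out third-order case `taylor_segment_three` (remainder `≤ (M/24)‖x − p‖⁴`), which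
part 27Va-B (`…FarFieldCellTaylor`) integrates over a Voronoi cell.  Mechanism: the one-variable
function `t ↦ g (p + t•v)` has `k`-th derivative `D^k g(p + t•v)[v,…,v]` (`hasDerivAt_alongLine`,
chain rule on `iteratedFDeriv`), so Mathlib's `taylor_mean_remainder_lagrange` applies on `[0, 1]`.
-/

namespace Summit.AtomisticToContinuum.Crystallization.Theorems.OverbindingBudgetAffineFarFieldTaylor

open Set Filter
open scoped Topology Nat

variable {E : Type*} [NormedAddCommGroup E] [NormedSpace ℝ E]

/-- `alongLine k g p v t = D^k g (p + t • v) [v, …, v]`: the `k`-th derivative of `g` along the line. -/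
noncomputable def alongLine (k : ℕ) (g : E → ℝ) (p v : E) (t : ℝ) : ℝ :=
  iteratedFDeriv ℝ k g (p + t • v) (fun _ => v)

/-- `alongLine_zero` (docstring added by the landing lane; see the module docstring). [formal bookkeeping] -/
theorem alongLine_zero (g : E → ℝ) (p v : E) (t : ℝ) : alongLine 0 g p v t = g (p + t • v) := by
  simp [alongLine]

-- LANE EDITION (hand-2 g44, gate `dedup.landed`): the node's `hasDerivAt_linePath` restates the landed
-- `Literature.Topology.FourManifolds.hasDerivAt_lineMap'` (identical statement); dropped, the Literature lemma is cited below.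

/-- Differentiating along the line raises the order by one. -/
theorem hasDerivAt_alongLine {U : Set E} (hU : IsOpen U) {g : E → ℝ} {n : ℕ}
    (hg : ContDiffOn ℝ n g U) {k : ℕ} (hk : k < n) {p v : E} {t : ℝ} (ht : p + t • v ∈ U) :
    HasDerivAt (alongLine k g p v) (alongLine (k + 1) g p v t) t := by
  have hga : ContDiffAt ℝ n g (p + t • v) := hg.contDiffAt (hU.mem_nhds ht)
  have hd : DifferentiableAt ℝ (iteratedFDeriv ℝ k g) (p + t • v) :=
    hga.differentiableAt_iteratedFDeriv (by exact_mod_cast hk)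
  have h1 : HasDerivAt (fun s : ℝ => iteratedFDeriv ℝ k g (p + s • v))
      (fderiv ℝ (iteratedFDeriv ℝ k g) (p + t • v) v) t :=
    hd.hasFDerivAt.comp_hasDerivAt t (Literature.Topology.FourManifolds.hasDerivAt_lineMap' p v t)
  have h2 := (ContinuousMultilinearMap.apply ℝ (fun _ : Fin k => E) ℝ (fun _ => v)).hasFDerivAt
    |>.comp_hasDerivAt t h1
  have e1 : (fun s : ℝ => (ContinuousMultilinearMap.apply ℝ (fun _ : Fin k => E) ℝ (fun _ => v))
      (iteratedFDeriv ℝ k g (p + s • v))) = alongLine k g p v := by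
    funext s; simp [alongLine]
  have e2 : (ContinuousMultilinearMap.apply ℝ (fun _ : Fin k => E) ℝ (fun _ => v))
      (fderiv ℝ (iteratedFDeriv ℝ k g) (p + t • v) v) = alongLine (k + 1) g p v t := by
    simp only [ContinuousMultilinearMap.apply_apply, alongLine, iteratedFDeriv_succ_apply_left]
    rfl
  rw [← e1, ← e2]
  exact h2

/-- The line function is `C^n` on the open preimage of `U`. -/
theorem contDiffOn_alongLine_zero {U : Set E} {g : E → ℝ} {n : ℕ}
    (hg : ContDiffOn ℝ n g U) (p v : E) :
    ContDiffOn ℝ n (alongLine 0 g p v) {t : ℝ | p + t • v ∈ U} := by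
  have hpath : ContDiff ℝ n (fun s : ℝ => p + s • v) := by fun_prop
  have h := hg.comp hpath.contDiffOn (fun t ht => ht)
  refine h.congr (fun t _ => ?_)
  simp [alongLine, Function.comp]

/-- `isOpen_linePreimage` (docstring added by the landing lane; see the module docstring). [formal bookkeeping] -/
theorem isOpen_linePreimage {U : Set E} (hU : IsOpen U) (p v : E) :
    IsOpen {t : ℝ | p + t • v ∈ U} := by
  have hc : Continuous (fun s : ℝ => p + s • v) := by fun_prop
  exact hU.preimage hc

/-- On the open preimage of `U`, the `k`-th one-variable derivative of the line function is
`alongLine k`. -/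
theorem iteratedDeriv_alongLine {U : Set E} (hU : IsOpen U) {g : E → ℝ} {n : ℕ}
    (hg : ContDiffOn ℝ n g U) (p v : E) :
    ∀ k, k ≤ n → ∀ t, p + t • v ∈ U → iteratedDeriv k (alongLine 0 g p v) t = alongLine k g p v t := by
  intro k
  induction k with
  | zero => intro _ t _; simp
  | succ k ih =>
    intro hk t ht
    rw [iteratedDeriv_succ]
    have hev : iteratedDeriv k (alongLine 0 g p v) =ᶠ[𝓝 t] alongLine k g p v := by
      have hmem : {s : ℝ | p + s • v ∈ U} ∈ 𝓝 t := (isOpen_linePreimage hU p v).mem_nhds ht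
      filter_upwards [hmem] with s hs
      exact ih (Nat.le_of_succ_le hk) s hs
    rw [hev.deriv_eq]
    exact (hasDerivAt_alongLine hU hg (Nat.lt_of_succ_le hk) ht).deriv

/-- Norm bound for the top derivative along the line. -/
theorem abs_alongLine_le {g : E → ℝ} {k : ℕ} {p v : E} {t M : ℝ}
    (hM : ‖iteratedFDeriv ℝ k g (p + t • v)‖ ≤ M) :
    |alongLine k g p v t| ≤ M * ‖v‖ ^ k := by
  unfold alongLine
  have h := (iteratedFDeriv ℝ k g (p + t • v)).le_opNorm (fun _ => v)
  simp only [Finset.prod_const, Finset.card_univ, Fintype.card_fin] at h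
  rw [← Real.norm_eq_abs]
  exact h.trans (by gcongr)

/-- **Taylor along a segment.**  If `g` is `C^{n+1}` on an open `U` containing the segment from `p`
to `p + v`, and `‖D^{n+1} g‖ ≤ M` on that segment, then
`|g (p + v) − Σ_{k ≤ n} D^k g(p)[v,…,v]/k!| ≤ M ‖v‖^{n+1}/(n+1)!`. -/
theorem taylor_segment {U : Set E} (hU : IsOpen U) {g : E → ℝ} {n : ℕ}
    (hg : ContDiffOn ℝ (n + 1) g U) {p v : E} (hseg : ∀ t ∈ Icc (0 : ℝ) 1, p + t • v ∈ U) {M : ℝ}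
    (hM : ∀ t ∈ Icc (0 : ℝ) 1, ‖iteratedFDeriv ℝ (n + 1) g (p + t • v)‖ ≤ M) :
    |g (p + v) - ∑ k ∈ Finset.range (n + 1), alongLine k g p v 0 / k !|
      ≤ M * ‖v‖ ^ (n + 1) / (n + 1)! := by
  set h : ℝ → ℝ := alongLine 0 g p v with hh
  have hJ : IsOpen {t : ℝ | p + t • v ∈ U} := isOpen_linePreimage hU p v
  have hcd : ContDiffOn ℝ (n + 1) h {t : ℝ | p + t • v ∈ U} := contDiffOn_alongLine_zero hg p v
  have hsub : Icc (0 : ℝ) 1 ⊆ {t : ℝ | p + t • v ∈ U} := fun t ht => hseg t ht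
  have hcdAt : ∀ t ∈ Icc (0 : ℝ) 1, ContDiffAt ℝ (n + 1) h t :=
    fun t ht => hcd.contDiffAt (hJ.mem_nhds (hsub ht))
  -- identification of the one-variable derivatives on `Icc 0 1`
  have hW : ∀ k, k ≤ n + 1 → ∀ t ∈ Icc (0 : ℝ) 1,
      iteratedDerivWithin k h (Icc 0 1) t = alongLine k g p v t := by
    intro k hk t ht
    have h01 : (0 : ℝ) < 1 := one_pos
    rw [iteratedDerivWithin_eq_iteratedDeriv (uniqueDiffOn_Icc h01)
      ((hcdAt t ht).of_le (by exact_mod_cast hk)) ht]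
    exact iteratedDeriv_alongLine hU hg p v k hk t (hsub ht)
  -- hypotheses of the Lagrange form
  have hf : ContDiffOn ℝ n h (uIcc (0 : ℝ) 1) := by
    rw [uIcc_of_le zero_le_one]
    exact (hcd.mono hsub).of_le (by exact_mod_cast Nat.le_succ n)
  have hf' : DifferentiableOn ℝ (iteratedDerivWithin n h (uIcc (0 : ℝ) 1)) (uIoo (0 : ℝ) 1) := by
    rw [uIcc_of_le zero_le_one, uIoo_of_le zero_le_one]
    intro t ht
    have htI : t ∈ Icc (0 : ℝ) 1 := Ioo_subset_Icc_self ht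
    have hdiff : DifferentiableAt ℝ (alongLine n g p v) t :=
      (hasDerivAt_alongLine hU hg (Nat.lt_succ_self n) (hsub htI)).differentiableAt
    refine (hdiff.differentiableWithinAt (s := Ioo (0 : ℝ) 1)).congr (fun s hs => ?_) ?_
    · exact hW n (Nat.le_succ n) s (Ioo_subset_Icc_self hs)
    · exact hW n (Nat.le_succ n) t htI
  obtain ⟨x', hx', hL⟩ := taylor_mean_remainder_lagrange (f := h) (n := n) zero_ne_one hf hf'
  rw [uIoo_of_le zero_le_one] at hx'
  rw [uIcc_of_le zero_le_one] at hL
  have hx'I : x' ∈ Icc (0 : ℝ) 1 := Ioo_subset_Icc_self hx'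
  -- rewrite the Taylor polynomial and the remainder
  have hT : taylorWithinEval h n (Icc 0 1) 0 1
      = ∑ k ∈ Finset.range (n + 1), alongLine k g p v 0 / k ! := by
    rw [taylor_within_apply]
    refine Finset.sum_congr rfl (fun k hk => ?_)
    have hk' : k ≤ n + 1 := by
      have := Finset.mem_range.mp hk; omega
    rw [hW k hk' 0 ⟨le_rfl, zero_le_one⟩]
    simp [smul_eq_mul, div_eq_inv_mul]
  have hR : iteratedDerivWithin (n + 1) h (Icc 0 1) x' = alongLine (n + 1) g p v x' :=
    hW (n + 1) le_rfl x' hx'I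
  have h1 : h 1 = g (p + v) := by simp [hh, alongLine_zero]
  rw [hT, hR, h1] at hL
  simp only [sub_zero, one_pow, mul_one] at hL
  rw [hL]
  have hb := abs_alongLine_le (hM x' hx'I)
  rw [abs_div, Nat.abs_cast]
  exact div_le_div_of_nonneg_right hb (by positivity)

/-- Third-order Taylor along a segment with the fourth-order Lagrange bound, terms spelled out. -/
theorem taylor_segment_three {U : Set E} (hU : IsOpen U) {g : E → ℝ} (hg : ContDiffOn ℝ 4 g U)
    {p x : E} (hseg : ∀ t ∈ Icc (0 : ℝ) 1, p + t • (x - p) ∈ U) {M : ℝ}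
    (hM : ∀ t ∈ Icc (0 : ℝ) 1, ‖iteratedFDeriv ℝ 4 g (p + t • (x - p))‖ ≤ M) :
    |g x - (g p + fderiv ℝ g p (x - p) + iteratedFDeriv ℝ 2 g p (fun _ => x - p) / 2
        + iteratedFDeriv ℝ 3 g p (fun _ => x - p) / 6)| ≤ M / 24 * ‖x - p‖ ^ 4 := by
  have hg' : ContDiffOn ℝ ((3 : ℕ) + 1) g U := hg.of_le (by norm_num)
  have h := taylor_segment hU (n := 3) hg' hseg hM
  have hs : ∑ k ∈ Finset.range (3 + 1), alongLine k g p (x - p) 0 / (k ! : ℝ)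
      = g p + fderiv ℝ g p (x - p) + iteratedFDeriv ℝ 2 g p (fun _ => x - p) / 2
        + iteratedFDeriv ℝ 3 g p (fun _ => x - p) / 6 := by
    simp only [Finset.sum_range_succ, Finset.sum_range_zero, alongLine, zero_smul, add_zero,
      iteratedFDeriv_zero_apply, iteratedFDeriv_one_apply, Nat.factorial]
    norm_num
  rw [hs, show p + (x - p) = x by abel] at h
  have h24 : M * ‖x - p‖ ^ (3 + 1) / ((3 + 1)! : ℝ) = M / 24 * ‖x - p‖ ^ 4 := by
    norm_num [Nat.factorial]; ring
  rw [h24] at h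
  exact h

end Summit.AtomisticToContinuum.Crystallization.Theorems.OverbindingBudgetAffineFarFieldTaylor
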